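import Summits.MatrixMultiplication.OmegaCensus.SmallFormats.MatMul228GF3K4Codes
import Summits.MatrixMultiplication.OmegaCensus.SmallFormats.MatMul22nZKEntries
import HarnessLib

/-!
# ω-census family (a): the ZERO entries of the K4 certificates — `K4Defs.zeroB ⇒ Q = 0` from the structure data (dispatcher, zero half)

Cell `pub-omega` (unit `pub-omega-tensor`, gen 42), topic `Summits/MatrixMultiplication/OmegaCensus` (sub-folder `SmallFormats`). Framing (verbatim): lottery
ticket; floor = certified bounds/negative ranges. HONEST FRAMING: step 2b (zero half) of the kernel route to «K4 is not an X-marginal» (K4-KERNEL-BLUEPRINT.md §8).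
The structure data of `K4Structure.structure_package` are taken in FAMILY form (the assembly `NoK4` repackages them once): ZKKI row singles `hZKrow` (explicit
rank-one Y-form shape + the null fact at the other single's column), empty blocks `hZ`, ZKKI column singles `hZKcol`, all-ones rows `Lrow/rowcode` with null facts
`hLa`, shapes `hLf` and code meaning `hrowcode`, all-ones columns `Mcol/colcode` likewise. THEOREM `Q_eq_zero_of_zeroB`: for single cells `s, t` with
`K4Defs.zeroB (rowcode 2) (rowcode 3) (colcode 1) (colcode 3) s t = true`, the entry `Σ_{p,q} Y q p · (W_s p ⬝ᵥ Grow_t q)` vanishes for EVERY `Y` — by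
`PairingZeros.Q_eq_zero_of_G_line / _of_W_line`: empty block, G-side shape zero (ZKKI single or all-ones rank-one cell whose kill index is the null representative of
the block), W-side shape zero. The non-zero half (`nonzeroB ⇒ Q ≠ 0`, via `ZKEntries`) and the assembly remain. Nothing here is a bound on `ω`.
-/

namespace Summit.MatrixMultiplication.OmegaCensus.SmallFormats

open Finset Matrix
open Literature.Computability.AlgebraicComplexity

namespace K4EntryZeros

/-- `kills = true` forces a non-pair label. -/
theorem pairMask_false_of_kills : ∀ (code : Fin 9) (v x : Fin 4), K4Defs.kills code v x = true → K4Defs.pairMask code v = false := by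
  unfold K4Defs.kills; decide

/-- **The zero dispatcher.** -/
theorem Q_eq_zero_of_zeroB (β : BilinComp (mulBilin (ZMod 3) 2 2 8) (Fin 27)) (Y : Matrix (Fin 2) (Fin 2) (ZMod 3))
    (c b : Fin 4 → Fin 2 → (Fin 8 → ZMod 3))
    (hcr : ∀ v s, s ∈ (![{15, 16, 17, 18}, {11, 12, 13, 14}, {23, 24, 25, 26}, {19, 20, 21, 22}] : Fin 4 → Finset (Fin 27)) v → ∀ κ : Fin 2, ∃ a : Fin 2 → ZMod 3, (fun j => β.g s (Matrix.single κ j (1 : ZMod 3))) = ∑ m, a m • c v m)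
    (hbr : ∀ μ s, s ∈ (![{16, 17, 20, 24}, {11, 15, 19, 23}, {13, 14, 22, 26}, {12, 18, 21, 25}] : Fin 4 → Finset (Fin 27)) μ → ∀ κ : Fin 2, ∃ a : Fin 2 → ZMod 3, β.w s κ = ∑ m, a m • b μ m)
    -- ZKKI row singles: explicit rank-one Y-form shapes and the null fact at the OTHER single's column
    (hZKrow : ∀ v μ : Fin 4, (v = 0 ∨ v = 1) → (μ = 1 ∨ μ = 3) → ∃ (e : ZMod 3) (r : Fin 4),
      (∀ q : Fin 2, (fun jj => β.g (K4Defs.cellTerm v μ) (Matrix.single q jj (1 : ZMod 3))) = (e * (![![1, 0], ![0, 1], ![1, 1], ![1, 2]] : Fin 4 → Fin 2 → ZMod 3) ((![0, 2, 0, 0] : Fin 4 → Fin 4) v) q) • ∑ l, (![![1, 0], ![0, 1], ![1, 1], ![1, 2]] : Fin 4 → Fin 2 → ZMod 3) r l • c v l) ∧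
      Matrix.vecMul ((![![1, 0], ![0, 1], ![1, 1], ![1, 2]] : Fin 4 → Fin 2 → ZMod 3) r) (Matrix.of fun l m => c v l ⬝ᵥ b ((![0, 3, 0, 1] : Fin 4 → Fin 4) μ) m : Matrix (Fin 2) (Fin 2) (ZMod 3)) = 0)
    -- empty blocks of the ZKKI rows
    (hZ : ∀ v : Fin 4, (v = 0 ∨ v = 1) → ∀ l m, c v l ⬝ᵥ b ((![2, 0, 0, 0] : Fin 4 → Fin 4) v) m = 0)
    -- ZKKI column singles: explicit rank-one output shapes and the null fact at the OTHER single's row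
    (hZKcol : ∀ v μ : Fin 4, (μ = 0 ∨ μ = 2) → (v = 2 ∨ v = 3) → ∃ (w : ZMod 3) (sx : Fin 4),
      (∀ q : Fin 2, β.w (K4Defs.cellTerm v μ) q = (w * (![![1, 0], ![0, 1], ![1, 1], ![1, 2]] : Fin 4 → Fin 2 → ZMod 3) ((![0, 0, 1, 0] : Fin 4 → Fin 4) μ) q) • ∑ l, (![![1, 0], ![0, 1], ![1, 1], ![1, 2]] : Fin 4 → Fin 2 → ZMod 3) sx l • b μ l) ∧
      Matrix.vecMul ((![![1, 0], ![0, 1], ![1, 1], ![1, 2]] : Fin 4 → Fin 2 → ZMod 3) sx) (Matrix.of fun l m => b μ l ⬝ᵥ c ((![0, 0, 3, 2] : Fin 4 → Fin 4) v) m : Matrix (Fin 2) (Fin 2) (ZMod 3)) = 0)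
    -- all-ones rows 2, 3: line maps with null facts, shapes and codes
    (Lrow : Fin 4 → Fin 4 → Fin 4) (rowcode : Fin 4 → Fin 9)
    (hLa : ∀ v : Fin 4, (v = 2 ∨ v = 3) → ∀ j m, (∑ l, (![![1, 0], ![0, 1], ![1, 1], ![1, 2]] : Fin 4 → Fin 2 → ZMod 3) (Lrow v j) l • c v l) ⬝ᵥ b j m = 0)
    (hLf : ∀ v : Fin 4, (v = 2 ∨ v = 3) → ∀ a bb j, a ≠ bb → Lrow v a = Lrow v bb → j ≠ a → j ≠ bb →
      ∃ η : Fin 2 → ZMod 3, ∀ q : Fin 2, (fun jj => β.g (K4Defs.cellTerm v j) (Matrix.single q jj (1 : ZMod 3))) = η q • ∑ l, (![![1, 0], ![0, 1], ![1, 1], ![1, 2]] : Fin 4 → Fin 2 → ZMod 3) (Lrow v a) l • c v l)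
    (hrowcode : ∀ v : Fin 4, (v = 2 ∨ v = 3) → ∀ a bb : Fin 4, Lrow v a = Lrow v bb ↔ K4Defs.same (rowcode v) a bb = true)
    -- all-ones columns 1, 3
    (Mcol : Fin 4 → Fin 4 → Fin 4) (colcode : Fin 4 → Fin 9)
    (hMa : ∀ μ : Fin 4, (μ = 1 ∨ μ = 3) → ∀ i m, (∑ l, (![![1, 0], ![0, 1], ![1, 1], ![1, 2]] : Fin 4 → Fin 2 → ZMod 3) (Mcol μ i) l • b μ l) ⬝ᵥ c i m = 0)
    (hMf : ∀ μ : Fin 4, (μ = 1 ∨ μ = 3) → ∀ a bb i, a ≠ bb → Mcol μ a = Mcol μ bb → i ≠ a → i ≠ bb →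
      ∃ ω : Fin 2 → ZMod 3, ∀ q : Fin 2, β.w (K4Defs.cellTerm i μ) q = ω q • ∑ l, (![![1, 0], ![0, 1], ![1, 1], ![1, 2]] : Fin 4 → Fin 2 → ZMod 3) (Mcol μ a) l • b μ l)
    (hcolcode : ∀ μ : Fin 4, (μ = 1 ∨ μ = 3) → ∀ a bb : Fin 4, Mcol μ a = Mcol μ bb ↔ K4Defs.same (colcode μ) a bb = true)
    (s t : Fin 4 × Fin 4) (hs : K4Defs.singleB s = true) (ht : K4Defs.singleB t = true)
    (hsC : K4Defs.cellTerm s.1 s.2 ∈ (![{16, 17, 20, 24}, {11, 15, 19, 23}, {13, 14, 22, 26}, {12, 18, 21, 25}] : Fin 4 → Finset (Fin 27)) s.2) (htR : K4Defs.cellTerm t.1 t.2 ∈ (![{15, 16, 17, 18}, {11, 12, 13, 14}, {23, 24, 25, 26}, {19, 20, 21, 22}] : Fin 4 → Finset (Fin 27)) t.1)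
    (hz : K4Defs.zeroB (rowcode 2) (rowcode 3) (colcode 1) (colcode 3) s t = true) :
    (∑ p, ∑ q, Y q p * (β.w (K4Defs.cellTerm s.1 s.2) p ⬝ᵥ (fun jj => β.g (K4Defs.cellTerm t.1 t.2) (Matrix.single q jj (1 : ZMod 3))))) = 0 := by
  classical
  obtain ⟨vs, ms⟩ := s
  obtain ⟨vt, mt⟩ := t
  simp only at hs ht hsC htR hz ⊢
  -- the output rows of `s` lie in `span(b ms)`, the Y-form rows of `t` in `span(c vt)`
  have hW : ∀ p, ∃ a : Fin 2 → ZMod 3, β.w (K4Defs.cellTerm vs ms) p = ∑ m, a m • b ms m := fun p => hbr ms _ hsC p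
  have hG : ∀ q, ∃ a : Fin 2 → ZMod 3, (fun jj => β.g (K4Defs.cellTerm vt mt) (Matrix.single q jj (1 : ZMod 3))) = ∑ m, a m • c vt m :=
    fun q => hcr vt _ htR q
  -- single cells: the row / column alternatives
  have hts : ((vt = 0 ∨ vt = 1) ∧ (mt = 1 ∨ mt = 3)) ∨ (vt = 2 ∨ vt = 3) := by
    revert ht; unfold K4Defs.singleB; simp only [Bool.or_eq_true, Bool.and_eq_true, decide_eq_true_eq]; exact id
  have hss : ((vs = 0 ∨ vs = 1) ∧ (ms = 1 ∨ ms = 3)) ∨ (vs = 2 ∨ vs = 3) := by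
    revert hs; unfold K4Defs.singleB; simp only [Bool.or_eq_true, Bool.and_eq_true, decide_eq_true_eq]; exact id
  -- the row code of an all-ones row / column code of an all-ones column, as used in `zeroB`
  have hrc : ∀ v : Fin 4, (v = 2 ∨ v = 3) → (![rowcode 2, rowcode 2, rowcode 2, rowcode 3] : Fin 4 → Fin 9) v = rowcode v := by
    rintro v (rfl | rfl) <;> rfl
  have hcc : ∀ μ : Fin 4, (μ = 1 ∨ μ = 3) → (![colcode 1, colcode 1, colcode 1, colcode 3] : Fin 4 → Fin 9) μ = colcode μ := by
    rintro μ (rfl | rfl) <;> rfl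
  unfold K4Defs.zeroB at hz
  simp only [Bool.or_eq_true, Bool.and_eq_true, decide_eq_true_eq] at hz
  rcases hz with (((h1 | h2) | h3) | h4) | h5
  · -- (Z1) empty block: t is a ZKKI single of row vt, s sits in the empty column of row vt
    obtain ⟨hv, hms⟩ := h1
    have hmt : mt = 1 ∨ mt = 3 := by
      rcases hts with ⟨-, h⟩ | h
      · exact h
      · rcases hv with rfl | rfl <;> rcases h with h | h <;> exact absurd h (by decide)
    obtain ⟨e, r, hshape, -⟩ := hZKrow vt mt hv hmt
    refine PairingZeros.Q_eq_zero_of_G_line Y (fun q jj => β.g (K4Defs.cellTerm vt mt) (Matrix.single q jj (1 : ZMod 3))) (β.w (K4Defs.cellTerm vs ms))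
      (∑ l, (![![1, 0], ![0, 1], ![1, 1], ![1, 2]] : Fin 4 → Fin 2 → ZMod 3) r l • c vt l) (fun q => e * (![![1, 0], ![0, 1], ![1, 1], ![1, 2]] : Fin 4 → Fin 2 → ZMod 3) ((![0, 2, 0, 0] : Fin 4 → Fin 4) vt) q) hshape (b ms) hW fun m => ?_
    rw [sum_dotProduct]
    refine Finset.sum_eq_zero fun l _ => ?_
    rw [smul_dotProduct, hms, hZ vt hv l m, smul_zero]
  · -- (ZG-ZK) t a ZKKI single, s in the OTHER single's column: the kill index of t is the null representative there
    obtain ⟨⟨hv, hmt⟩, hms⟩ := h2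
    obtain ⟨e, r, hshape, hnull⟩ := hZKrow vt mt hv hmt
    refine PairingZeros.Q_eq_zero_of_G_line Y (fun q jj => β.g (K4Defs.cellTerm vt mt) (Matrix.single q jj (1 : ZMod 3))) (β.w (K4Defs.cellTerm vs ms))
      (∑ l, (![![1, 0], ![0, 1], ![1, 1], ![1, 2]] : Fin 4 → Fin 2 → ZMod 3) r l • c vt l) (fun q => e * (![![1, 0], ![0, 1], ![1, 1], ![1, 2]] : Fin 4 → Fin 2 → ZMod 3) ((![0, 2, 0, 0] : Fin 4 → Fin 4) vt) q) hshape (b ms) hW fun m => ?_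
    rw [hms, GramNondeg.combo_dotProduct_eq_vecMul, hnull, Pi.zero_apply]
  · -- (ZG-all-ones) t in an all-ones row, rank one, its kill index is the null representative of the block at column ms
    obtain ⟨hv, hk⟩ := h3
    rw [hrc vt hv] at hk
    have hpm := pairMask_false_of_kills _ _ _ hk
    obtain ⟨a, bb, hab, hja, hjb, hsame, hkill⟩ := K4Codes.offpair_data (rowcode vt) mt hpm
    have hLab : Lrow vt a = Lrow vt bb := (hrowcode vt hv a bb).mpr hsame
    have hLms : Lrow vt ms = Lrow vt a := (hrowcode vt hv ms a).mpr (by rw [← hkill ms]; exact hk)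
    obtain ⟨η, hη⟩ := hLf vt hv a bb mt hab hLab hja hjb
    refine PairingZeros.Q_eq_zero_of_G_line Y (fun q jj => β.g (K4Defs.cellTerm vt mt) (Matrix.single q jj (1 : ZMod 3))) (β.w (K4Defs.cellTerm vs ms))
      (∑ l, (![![1, 0], ![0, 1], ![1, 1], ![1, 2]] : Fin 4 → Fin 2 → ZMod 3) (Lrow vt a) l • c vt l) η hη (b ms) hW fun m => ?_
    rw [← hLms]; exact hLa vt hv ms m
  · -- (ZW-ZK) s a ZKKI column single, t in the OTHER single's row
    obtain ⟨⟨hms, hvs⟩, hvt⟩ := h4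
    obtain ⟨w, sx, hshape, hnull⟩ := hZKcol vs ms hms hvs
    refine PairingZeros.Q_eq_zero_of_W_line Y (fun q jj => β.g (K4Defs.cellTerm vt mt) (Matrix.single q jj (1 : ZMod 3))) (β.w (K4Defs.cellTerm vs ms))
      (∑ l, (![![1, 0], ![0, 1], ![1, 1], ![1, 2]] : Fin 4 → Fin 2 → ZMod 3) sx l • b ms l) (fun q => w * (![![1, 0], ![0, 1], ![1, 1], ![1, 2]] : Fin 4 → Fin 2 → ZMod 3) ((![0, 0, 1, 0] : Fin 4 → Fin 4) ms) q) hshape (c vt) hG fun m => ?_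
    rw [hvt, GramNondeg.combo_dotProduct_eq_vecMul, hnull, Pi.zero_apply]
  · -- (ZW-all-ones) s in an all-ones column, rank one, its kill index is the null representative of the block at row vt
    obtain ⟨hms, hk⟩ := h5
    have hms' : ms = 1 ∨ ms = 3 := hms
    rw [hcc ms hms'] at hk
    have hpm := pairMask_false_of_kills _ _ _ hk
    obtain ⟨a, bb, hab, hia, hib, hsame, hkill⟩ := K4Codes.offpair_data (colcode ms) vs hpm
    have hMab : Mcol ms a = Mcol ms bb := (hcolcode ms hms' a bb).mpr hsame
    have hMvt : Mcol ms vt = Mcol ms a := (hcolcode ms hms' vt a).mpr (by rw [← hkill vt]; exact hk)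
    obtain ⟨ω, hω⟩ := hMf ms hms' a bb vs hab hMab hia hib
    refine PairingZeros.Q_eq_zero_of_W_line Y (fun q jj => β.g (K4Defs.cellTerm vt mt) (Matrix.single q jj (1 : ZMod 3))) (β.w (K4Defs.cellTerm vs ms))
      (∑ l, (![![1, 0], ![0, 1], ![1, 1], ![1, 2]] : Fin 4 → Fin 2 → ZMod 3) (Mcol ms a) l • b ms l) ω hω (c vt) hG fun m => ?_
    rw [← hMvt]; exact hMa ms hms' vt m

end K4EntryZeros

end Summit.MatrixMultiplication.OmegaCensus.SmallFormats
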